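import Mathlib
import Literature.Probability.Percolation.Percolation
import Literature.Probability.Percolation.RSW
import Literature.Probability.Percolation.PlanarDuality
import Literature.Probability.Percolation.LayerPeeling
import Literature.Probability.Percolation.DiagonalStripColumns
import HarnessLib

/-!
# Column connectivity patterns of the diagonal percolation strip and their exact transfer

Topic `Literature/Probability/Percolation`. Dictionary step (i) of the named fact
`Literature.Probability.Percolation.IkhlefPonsaingFirstPassage` (Ikhlef–Ponsaing, J. Stat. Phys.
149 (2012), arXiv:1202.5476), deterministic part, for the strip `0 ≤ x₀ + x₁ ≤ 2m+1` of `ℤ²`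
itself (the generic peeling lemma is `LayerPeeling.lean`). IP12 §3.1 (held text p. 5): "Drawing a
horizontal line across the width of the lattice, we consider the connectivities of the loops below
the line … a link pattern … We look at all the possible configurations of two rows of the lattice,
and consider how they send a given link pattern to another … the transfer matrix `t`. We take an
arbitrary initial state `|in⟩` and act `N` times with the transfer matrix". Here, in the cluster
(bond) language of the named fact and one diagonal column (= one row of `L = 2m+1` tiles) at a
time:

* Coordinates: `colSite c j` is the `j`-th site of the column `x₀ - x₁ = c` (level
  `x₀ + x₁ = 2j + (c mod 2)`); the column of the strip is `{colSite c j | j ≤ m}` (`mem_ipCol_iff`);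
  `ipBox m a` is the strip truncated on the left at column `a`, `ipHalf m a c` its part left of
  column `c`, `boxCol m a c` its column `c`.
* `ColPattern m` (a finite type) and `colPattern ω m a c`: which pairs of column-`c` sites are joined
  by open paths inside `ipHalf m a c`, and which sites are joined there to the wall `x₀ + x₁ = 0`
  (the cluster-language link pattern, with the wall playing the unpaired line).
* `colUpdate m c P E` — the deterministic update by the open edges `E` between columns `c` and
  `c + 1` (equivalence closure of old pattern ∪ cross edges; wall contacts inherited or created at
  the new column's wall site), and **`colPattern_succ`**: for a lattice configuration and `a ≤ c`,
  `colPattern ω m a (c+1) = colUpdate m c (colPattern ω m a c) (colEdges ω m c)` — from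
  `openConnIn_diagHalf_succ_iff` (peeling), a transport lemma for equivalence closures along the
  injective site encoding (`eqvGen_iff_of_injective`) and a last-exit lemma for wall contacts
  (`exists_lastExit_of_openConnIn`).
* `colPattern_self` (a bare column has the trivial pattern `colInit`) and
  **`colPattern_eq_colIter`**: the pattern at column `a + n` is the `n`-fold iterate `colIter` of the
  update over the edge layers — a function of the open edges between consecutive columns only
  (`colIter_congr`, `colEdges_congr`). This is the exactness statement "`|pattern⟩ = t^N |in⟩`"
  configuration by configuration; averaging it over the i.i.d. layers (the stochastic matrix, its
  powers and its Perron vector) is the probabilistic half, not done here.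

## References

* Y. Ikhlef, A. K. Ponsaing, J. Stat. Phys. 149 (2012) 10–36, arXiv:1202.5476, §2.2, §3.1.
  [IkhlefPonsaing2012]
-/

namespace Literature.Probability.Percolation

open Literature.Probability.LatticeModels

/-! ### Column patterns and their deterministic update -/

section Patterns

/-- A **column pattern** of the width-`(2m+1)` strip: which pairs of the `m+1` column sites are
joined (inside the half-strip to the left of the column), and which column sites are joined there to
the wall `x₀ + x₁ = 0` — a finite type (IP12 §3.1's "link patterns", in the cluster language).
[cite: IkhlefPonsaing2012, §3.1] -/
abbrev ColPattern (m : ℕ) : Type := (Fin (m + 1) → Fin (m + 1) → Bool) × (Fin (m + 1) → Bool)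

open Classical in
/-- The pattern of the configuration `ω` at column `c` of the strip truncated at `a`:
`(i, j) ↦ {colSite c i ↔ colSite c j in ipHalf m a c}` and `i ↦ {colSite c i ↔ wall in ipHalf m a c}`.
[cite: IkhlefPonsaing2012, §3.1] -/
noncomputable def colPattern (ω : BondConfig (Site 2)) (m : ℕ) (a c : ℤ) : ColPattern m :=
  (fun i j => decide (ω ∈ openConnIn (ipHalf m a c) (colSite c i) (colSite c j)),
    fun i => decide (∃ w : Site 2, w 0 + w 1 = 0 ∧ ω ∈ openConnIn (ipHalf m a c) (colSite c i) w))

open Classical in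
/-- The open edges between column `c` (site `i`) and column `c+1` (site `j`). [cite: IkhlefPonsaing2012, §3.1] -/
noncomputable def colEdges (ω : BondConfig (Site 2)) (m : ℕ) (c : ℤ) :
    Fin (m + 1) → Fin (m + 1) → Bool :=
  fun i j => decide (s(colSite c i, colSite (c + 1) j) ∈ ω)

/-- The one-step relation on old sites `inl i` (column `c`) and new sites `inr j` (column `c+1`):
old pairs related by the old pattern, old–new pairs by an open edge. [cite: IkhlefPonsaing2012, §3.1] -/
def updRel (m : ℕ) (P : ColPattern m) (E : Fin (m + 1) → Fin (m + 1) → Bool) :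
    Fin (m + 1) ⊕ Fin (m + 1) → Fin (m + 1) ⊕ Fin (m + 1) → Prop
  | Sum.inl i, Sum.inl i' => P.1 i i' = true
  | Sum.inl i, Sum.inr j => E i j = true
  | Sum.inr j, Sum.inl i => E i j = true
  | Sum.inr _, Sum.inr _ => False

/-- Wall contacts available after the step: an old site already joined to the wall, or the new
column's own wall site (`j = 0`, present iff `c + 1` is even). [cite: IkhlefPonsaing2012, §3.1] -/
def updWall (m : ℕ) (c : ℤ) (P : ColPattern m) : Fin (m + 1) ⊕ Fin (m + 1) → Prop
  | Sum.inl i => P.2 i = true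
  | Sum.inr j => (c + 1) % 2 = 0 ∧ (j : ℕ) = 0

open Classical in
/-- **The deterministic update** of column patterns (one column of IP12's transfer matrix, §3.1):
new sites are joined iff equivalent under the closure of `updRel`; a new site touches the wall iff
it is equivalent to a wall contact. [cite: IkhlefPonsaing2012, §3.1] -/
noncomputable def colUpdate (m : ℕ) (c : ℤ) (P : ColPattern m)
    (E : Fin (m + 1) → Fin (m + 1) → Bool) : ColPattern m :=
  (fun j j' => decide (Relation.EqvGen (updRel m P E) (Sum.inr j) (Sum.inr j')),
    fun j => decide (∃ z, Relation.EqvGen (updRel m P E) (Sum.inr j) z ∧ updWall m c P z))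

/-- The encoding of old and new column sites as lattice sites. [folklore] -/
def colEnc (m : ℕ) (c : ℤ) : Fin (m + 1) ⊕ Fin (m + 1) → Site 2
  | Sum.inl i => colSite c i
  | Sum.inr j => colSite (c + 1) j

/-- The encoding is injective. [folklore] -/
theorem colEnc_injective (m : ℕ) (c : ℤ) : Function.Injective (colEnc m c) := by
  rintro (i | j) (i' | j') h <;> simp only [colEnc] at h
  · exact congrArg Sum.inl (Fin.ext (colSite_injective c h))
  · exact absurd h (colSite_ne_colSite_succ c i j')
  · exact absurd h.symm (colSite_ne_colSite_succ c i' j)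
  · exact congrArg Sum.inr (Fin.ext (colSite_injective (c + 1) h))

/-- The encoding ranges over the two columns. [folklore] -/
theorem mem_range_colEnc_iff {m : ℕ} {a c : ℤ} (ha : a ≤ c) {x : Site 2} :
    x ∈ Set.range (colEnc m c) ↔ x ∈ boxCol m a (c + 1) ∪ boxCol m a c := by
  rw [Set.mem_union, mem_boxCol_iff ha, mem_boxCol_iff (by omega : a ≤ c + 1)]
  constructor
  · rintro ⟨i | j, rfl⟩
    · exact Or.inr (colSite_mem_ipCol (Nat.lt_succ_iff.1 i.2))
    · exact Or.inl (colSite_mem_ipCol (Nat.lt_succ_iff.1 j.2))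
  · rintro (h | h)
    · obtain ⟨j, hj, rfl⟩ := exists_eq_colSite_of_mem_ipCol h
      exact ⟨Sum.inr ⟨j, Nat.lt_succ_iff.2 hj⟩, rfl⟩
    · obtain ⟨j, hj, rfl⟩ := exists_eq_colSite_of_mem_ipCol h
      exact ⟨Sum.inl ⟨j, Nat.lt_succ_iff.2 hj⟩, rfl⟩

/-- A site of column `c + 1` is not in column `c`. [folklore] -/
theorem colSite_succ_not_mem_boxCol (m : ℕ) (a c : ℤ) (j : ℕ) : colSite (c + 1) j ∉ boxCol m a c := by
  rintro ⟨-, h⟩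
  simp only [Set.mem_setOf_eq, colSite_sub] at h
  omega

/-- A site of column `c + 1` is not to the left of column `c`. [folklore] -/
theorem colSite_succ_not_mem_ipHalf (m : ℕ) (a c : ℤ) (j : ℕ) : colSite (c + 1) j ∉ ipHalf m a c := by
  rintro ⟨-, h⟩
  simp only [Set.mem_setOf_eq, colSite_sub] at h
  omega

/-- The left regions increase with `c`. [folklore] -/
theorem ipHalf_subset_ipHalf_succ (m : ℕ) (a c : ℤ) : ipHalf m a c ⊆ ipHalf m a (c + 1) := by
  rintro x ⟨hx, h⟩
  exact ⟨hx, by simp only [Set.mem_setOf_eq] at h ⊢; omega⟩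

/-- `colSite c j`, `j ≤ m`, `a ≤ c`, lies in column `c` of the truncated strip. [folklore] -/
theorem colSite_mem_boxCol {m : ℕ} {a c : ℤ} (ha : a ≤ c) {j : ℕ} (hj : j ≤ m) :
    colSite c j ∈ boxCol m a c :=
  (mem_boxCol_iff ha).2 (colSite_mem_ipCol hj)

variable {ω : BondConfig (Site 2)}

/-- The peeling relation of the strip pulls back along the encoding to `updRel`. [folklore] -/
theorem peelRel_colEnc_iff (hω : ω ⊆ (zdGraph 2).edgeSet) (m : ℕ) {a c : ℤ} (ha : a ≤ c)
    (u v : Fin (m + 1) ⊕ Fin (m + 1)) :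
    ((colEnc m c u ∈ boxCol m a (c + 1) ∪ boxCol m a c ∧ colEnc m c v ∈ boxCol m a (c + 1) ∪ boxCol m a c ∧
        (openGraph ω).Adj (colEnc m c u) (colEnc m c v)) ∨
      (colEnc m c u ∈ boxCol m a c ∧ colEnc m c v ∈ boxCol m a c ∧
        ω ∈ openConnIn (ipHalf m a c) (colEnc m c u) (colEnc m c v))) ↔
      updRel m (colPattern ω m a c) (colEdges ω m c) u v := by
  have hmem : ∀ z, colEnc m c z ∈ boxCol m a (c + 1) ∪ boxCol m a c :=
    fun z => (mem_range_colEnc_iff ha).1 ⟨z, rfl⟩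
  rcases u with i | j <;> rcases v with i' | j' <;>
    simp only [colEnc, updRel, colPattern, colEdges, decide_eq_true_eq]
  · constructor
    · rintro (⟨-, -, h⟩ | ⟨-, -, h⟩)
      · exact absurd (hω ((openGraph_adj ω _ _).1 h).1) (not_adj_colSite_colSite c i i')
      · exact h
    · intro h
      exact Or.inr ⟨colSite_mem_boxCol ha (Nat.lt_succ_iff.1 i.2),
        colSite_mem_boxCol ha (Nat.lt_succ_iff.1 i'.2), h⟩
  · constructor
    · rintro (⟨-, -, h⟩ | ⟨-, h, -⟩)
      · exact ((openGraph_adj ω _ _).1 h).1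
      · exact absurd h (colSite_succ_not_mem_boxCol m a c j')
    · intro h
      exact Or.inl ⟨hmem (Sum.inl i), hmem (Sum.inr j'),
        (openGraph_adj ω _ _).2 ⟨h, colSite_ne_colSite_succ c i j'⟩⟩
  · constructor
    · rintro (⟨-, -, h⟩ | ⟨h, -, -⟩)
      · have := ((openGraph_adj ω _ _).1 h).1
        rwa [Sym2.eq_swap] at this
      · exact absurd h (colSite_succ_not_mem_boxCol m a c j)
    · intro h
      refine Or.inl ⟨hmem (Sum.inr j), hmem (Sum.inl i'), (openGraph_adj ω _ _).2 ⟨?_, ?_⟩⟩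
      · rwa [Sym2.eq_swap]
      · exact (colSite_ne_colSite_succ c i' j).symm
  · constructor
    · rintro (⟨-, -, h⟩ | ⟨h, -, -⟩)
      · exact absurd (hω ((openGraph_adj ω _ _).1 h).1) (not_adj_colSite_colSite (c + 1) j j')
      · exact absurd h (colSite_succ_not_mem_boxCol m a c j)
    · intro h
      exact h.elim

/-- **Connectivity of the new column is the closure of `updRel`.** [cite: IkhlefPonsaing2012, §3.1] -/
theorem openConnIn_ipHalf_succ_iff_eqvGen (hω : ω ⊆ (zdGraph 2).edgeSet) (m : ℕ) {a c : ℤ}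
    (ha : a ≤ c) (u v : Fin (m + 1) ⊕ Fin (m + 1)) :
    ω ∈ openConnIn (ipHalf m a (c + 1)) (colEnc m c u) (colEnc m c v) ↔
      Relation.EqvGen (updRel m (colPattern ω m a c) (colEdges ω m c)) u v := by
  have hmem : ∀ z, colEnc m c z ∈ boxCol m a (c + 1) ∪ boxCol m a c :=
    fun z => (mem_range_colEnc_iff ha).1 ⟨z, rfl⟩
  have hpeel := openConnIn_diagHalf_succ_iff hω (ipBox m a) c (hmem u) (hmem v)
  refine Iff.trans hpeel ?_
  refine eqvGen_iff_of_injective (colEnc m c) (colEnc_injective m c) (peelRel_colEnc_iff hω m ha) ?_ u v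
  rintro x y (⟨hx, hy, -⟩ | ⟨hx, hy, -⟩)
  · exact ⟨(mem_range_colEnc_iff ha).2 hx, (mem_range_colEnc_iff ha).2 hy⟩
  · exact ⟨(mem_range_colEnc_iff ha).2 (Or.inr hx), (mem_range_colEnc_iff ha).2 (Or.inr hy)⟩

/-- **Wall contact of the new column.** [cite: IkhlefPonsaing2012, §3.1] -/
theorem wall_ipHalf_succ_iff (hω : ω ⊆ (zdGraph 2).edgeSet) (m : ℕ) {a c : ℤ} (ha : a ≤ c)
    (j : Fin (m + 1)) :
    (∃ w : Site 2, w 0 + w 1 = 0 ∧ ω ∈ openConnIn (ipHalf m a (c + 1)) (colSite (c + 1) j) w) ↔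
      ∃ z, Relation.EqvGen (updRel m (colPattern ω m a c) (colEdges ω m c)) (Sum.inr j) z ∧
        updWall m c (colPattern ω m a c) z := by
  constructor
  · rintro ⟨w, hw0, hconn⟩
    have hwmem : w ∈ ipHalf m a (c + 1) := hconn.2.1
    rw [ipHalf_succ] at hwmem
    rcases hwmem with hwA | hwB
    · -- `w` in the old half: last exit through the frontier column
      rw [ipHalf_succ] at hconn
      obtain ⟨f, hf, h1, h2⟩ := exists_lastExit_of_openConnIn (B := boxCol m a (c + 1))
        (F := boxCol m a c) (diagColumn_frontier hω (ipBox m a) c) hwA hconn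
      rcases hf with hfF | rfl
      · obtain ⟨i, hi, rfl⟩ := exists_eq_colSite_of_mem_ipCol ((mem_boxCol_iff ha).1 hfF)
        refine ⟨Sum.inl ⟨i, Nat.lt_succ_iff.2 hi⟩, ?_, ?_⟩
        · rw [← openConnIn_ipHalf_succ_iff_eqvGen hω m ha]
          rw [ipHalf_succ]
          exact h1
        · simp only [updWall, colPattern, decide_eq_true_eq]
          exact ⟨w, hw0, h2⟩
      · exact absurd h2.1 (colSite_succ_not_mem_ipHalf m a c j)
    · obtain ⟨j', hj', rfl⟩ :=
        exists_eq_colSite_of_mem_ipCol ((mem_boxCol_iff (by omega : a ≤ c + 1)).1 hwB)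
      refine ⟨Sum.inr ⟨j', Nat.lt_succ_iff.2 hj'⟩, ?_, ?_⟩
      · rw [← openConnIn_ipHalf_succ_iff_eqvGen hω m ha]
        exact hconn
      · have := colSite_add (c + 1) j'
        simp only [updWall]
        omega
  · rintro ⟨z, hz, hwall⟩
    rcases z with i | j'
    · simp only [updWall, colPattern, decide_eq_true_eq] at hwall
      obtain ⟨w, hw0, hconn⟩ := hwall
      rw [← openConnIn_ipHalf_succ_iff_eqvGen hω m ha] at hz
      exact ⟨w, hw0, PlanarDuality.openConnIn_trans hz
        (openConnIn_mono (ipHalf_subset_ipHalf_succ m a c) _ _ hconn)⟩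
    · simp only [updWall] at hwall
      rw [← openConnIn_ipHalf_succ_iff_eqvGen hω m ha] at hz
      refine ⟨colSite (c + 1) j', ?_, hz⟩
      have := colSite_add (c + 1) j'
      omega

/-- **Column-to-column exactness of patterns** (the deterministic content of IP12 §3.1's transfer
matrix for the diagonal percolation strip): for a lattice configuration, the pattern at column
`c + 1` is the update of the pattern at column `c` by the open edges in between.
[cite: IkhlefPonsaing2012, §3.1] -/
theorem colPattern_succ (hω : ω ⊆ (zdGraph 2).edgeSet) (m : ℕ) {a c : ℤ} (ha : a ≤ c) :
    colPattern ω m a (c + 1) = colUpdate m c (colPattern ω m a c) (colEdges ω m c) := by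
  classical
  refine Prod.ext (funext fun j => funext fun j' => ?_) (funext fun j => ?_)
  · simp only [colPattern, colUpdate]
    rw [decide_eq_decide]
    exact openConnIn_ipHalf_succ_iff_eqvGen hω m ha (Sum.inr j) (Sum.inr j')
  · simp only [colUpdate]
    show decide _ = decide _
    rw [decide_eq_decide]
    exact wall_ipHalf_succ_iff hω m ha j

/-! ### The left edge and the iteration over columns -/

/-- The pattern of a bare column: only trivial connections; the wall is touched iff the column
contains a wall site (`a` even) and the site is it (`i = 0`). [cite: IkhlefPonsaing2012, §3.1] -/
def colInit (m : ℕ) (a : ℤ) : ColPattern m :=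
  (fun i j => decide (i = j), fun i => decide (a % 2 = 0 ∧ (i : ℕ) = 0))

/-- Inside a single column there are no open lattice edges: `{x ↔ y in ipHalf m a a}` iff `x = y`
(a site of that column). [folklore] -/
theorem openConnIn_ipHalf_self_iff (hω : ω ⊆ (zdGraph 2).edgeSet) (m : ℕ) (a : ℤ) (x y : Site 2) :
    ω ∈ openConnIn (ipHalf m a a) x y ↔ x = y ∧ x ∈ ipHalf m a a := by
  constructor
  · rintro ⟨hx, hy, ⟨p⟩⟩
    refine ⟨?_, hx⟩
    cases p with
    | nil => rfl
    | @cons _ v _ hadj _ =>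
      exfalso
      have hadj' : (openGraph ω).Adj x (v : Site 2) := by
        rw [SimpleGraph.induce_adj] at hadj; exact hadj
      have h1 : x 0 - x 1 = a := by
        have := hx.1.2; have := hx.2; simp only [Set.mem_setOf_eq] at *; omega
      have h2 : (v : Site 2) 0 - (v : Site 2) 1 = a := by
        have := v.2.1.2; have := v.2.2; simp only [Set.mem_setOf_eq] at *; omega
      have hadjZ : (zdGraph 2).Adj x (v : Site 2) := hω ((openGraph_adj ω _ _).1 hadj').1
      rcases zdGraph_two_adj_sub_sub hadjZ with h | h <;> omega
  · rintro ⟨rfl, hx⟩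
    exact ⟨hx, hx, SimpleGraph.Reachable.refl _⟩

/-- **The left edge.** At the first column `a` of the truncated strip the pattern is `colInit`.
[cite: IkhlefPonsaing2012, §3.1] -/
theorem colPattern_self (hω : ω ⊆ (zdGraph 2).edgeSet) (m : ℕ) (a : ℤ) :
    colPattern ω m a a = colInit m a := by
  classical
  have hmem : ∀ i : Fin (m + 1), colSite a i ∈ ipHalf m a a := fun i =>
    ⟨⟨colSite_mem_ipStrip.2 (Nat.lt_succ_iff.1 i.2),
      show a ≤ colSite a i 0 - colSite a i 1 by rw [colSite_sub]⟩,
      show colSite a i 0 - colSite a i 1 ≤ a by rw [colSite_sub]⟩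
  refine Prod.ext (funext fun i => funext fun j => ?_) (funext fun i => ?_)
  · simp only [colPattern, colInit]
    rw [decide_eq_decide, openConnIn_ipHalf_self_iff hω]
    constructor
    · rintro ⟨h, -⟩
      exact Fin.ext (colSite_injective a h)
    · rintro rfl
      exact ⟨rfl, hmem i⟩
  · simp only [colPattern, colInit]
    rw [decide_eq_decide]
    constructor
    · rintro ⟨w, hw0, hconn⟩
      rw [openConnIn_ipHalf_self_iff hω] at hconn
      obtain ⟨rfl, -⟩ := hconn
      have := colSite_add a i
      omega
    · rintro ⟨ha, hi⟩
      refine ⟨colSite a i, ?_, (openConnIn_ipHalf_self_iff hω m a _ _).2 ⟨rfl, hmem i⟩⟩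
      have := colSite_add a i
      omega

/-- Iterating the update over the edge layers `E c` (between columns `c` and `c+1`), starting from
the bare column `a`. [cite: IkhlefPonsaing2012, §3.1] -/
noncomputable def colIter (m : ℕ) (a : ℤ) (E : ℤ → Fin (m + 1) → Fin (m + 1) → Bool) :
    ℕ → ColPattern m
  | 0 => colInit m a
  | n + 1 => colUpdate m (a + n) (colIter m a E n) (E (a + n))

/-- **Transfer-matrix exactness for the truncated diagonal strip (deterministic form).** For a
lattice configuration, the pattern at column `a + n` of the strip truncated at column `a` is the
`n`-fold iterate of the column update applied to the open edge layers between consecutive columns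
— a function of those `n` layers alone (IP12 §3.1: `t^N |in⟩`). [cite: IkhlefPonsaing2012, §3.1] -/
theorem colPattern_eq_colIter (hω : ω ⊆ (zdGraph 2).edgeSet) (m : ℕ) (a : ℤ) (n : ℕ) :
    colPattern ω m a (a + n) = colIter m a (colEdges ω m) n := by
  induction n with
  | zero =>
    rw [colIter, Nat.cast_zero, add_zero]
    exact colPattern_self hω m a
  | succ n ih =>
    rw [colIter, ← ih, show a + ((n + 1 : ℕ) : ℤ) = a + n + 1 by push_cast; ring]
    exact colPattern_succ hω m (by omega)

/-- The iterate depends only on the layers `E (a + k)`, `k < n`. [folklore] -/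
theorem colIter_congr {m : ℕ} {a : ℤ} {E E' : ℤ → Fin (m + 1) → Fin (m + 1) → Bool} {n : ℕ}
    (h : ∀ k < n, E (a + k) = E' (a + k)) : colIter m a E n = colIter m a E' n := by
  induction n with
  | zero => rfl
  | succ n ih =>
    simp only [colIter]
    rw [ih fun k hk => h k (Nat.lt_succ_of_lt hk), h n (Nat.lt_succ_self n)]

/-- The edge layer `colEdges ω m c` depends only on the edges of `ω` between the columns `c` and
`c + 1`. [folklore] -/
theorem colEdges_congr {ω ω' : BondConfig (Site 2)} {m : ℕ} {c : ℤ}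
    (h : ∀ i j : Fin (m + 1), s(colSite c i, colSite (c + 1) j) ∈ ω ↔ s(colSite c i, colSite (c + 1) j) ∈ ω') :
    colEdges ω m c = colEdges ω' m c := by
  classical
  funext i j
  simp only [colEdges]
  rw [decide_eq_decide]
  exact h i j

end Patterns

end Literature.Probability.Percolation
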